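import Literature.Probability.Percolation.IsoradialRectangularLoops
import Literature.Probability.Percolation.StarTriangleIsoradial
import HarnessLib

/-!
# The isoradial square lattices `𝕃(𝛂)` with a sequence of track angles, and `φ_{𝕃(𝛂)}` at `q = 1`

Duminil-Copin–Kozlowski–Krachun–Manolescu–Oulamara, arXiv:2012.11672v2 (2026), §2.1–2.2: the
isoradial graphs of the paper "will all be isoradial embeddings of the square lattice in which
all rhombi of `𝔾^⋄` have bottom and top edges that are horizontal. A consequence of this
assumption is that the diamond graph contains horizontal tracks `t_i` with transverse angles
`α_i ∈ (0, π)` and vertical tracks `s_j`, all of which have transverse angle `0`. [...] For a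
sequence of track angles `𝛂 = (α_i)_{i ∈ ℤ} ∈ (0, π)^ℤ`, denote by `𝕃(𝛂)` the graph whose
horizontal tracks have transverse angles `α_i`, in increasing vertical order. When `α_i = α` for
every `i`, simply write `𝕃(α) = 𝕃(𝛂)`." These mixed lattices carry the configuration chain of the
proof of Theorem 1.9 (§3.1) and the track-exchange operators `𝐓_i` (§2.6, exchanging `t_i` and
`t_{i-1}`, i.e. `α_i` and `α_{i-1}`), whose elementary step is the star–triangle coupling of
`StarTriangle`/`StarTriangleCoupling`.

This file fixes the vocabulary, compatibly with `IsoradialRectangularLoops` (the constant case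
`𝕃(α)`): the combinatorial graph is the tree's `ℤ²` (`zdGraph 2`); the site `(x, y)` lies in the
row `t⁻_{x+y}` of vertices between the tracks `t_{x+y-1}` and `t_{x+y}`, at horizontal position
`x - y`; the rhombus of the track `t_i` has sides `1` (transverse direction of the vertical
tracks) and `e^{iα_i}`, so that

* `mixedPoint δ αs (x, y) = δ ((x - y) + H(x + y))`, `H(0) = 0`, `H(n+1) = H(n) + e^{iα_n}`
  (`trackHeight`); the "horizontal" edge `(x, y) → (x+1, y)` is the long diagonal
  `1 + e^{iα_{x+y}}` of its rhombus (length `2 cos(α_{x+y}/2)`, direction `α_{x+y}/2`) and the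
  "vertical" edge `(x, y) → (x, y+1)` the short diagonal `e^{iα_{x+y}} - 1` (length
  `2 sin(α_{x+y}/2)`) — `mixedPoint_add_single_zero`, `mixedPoint_add_single_one`,
  `norm_one_add_exp_mul_I`, `norm_exp_mul_I_sub_one`; for constant angles this is the embedding
  `isoRectPoint` of `𝕃(α)` (`mixedPoint_const`);
* the critical weights at `q = 1` (§2.2 eq. (9) with `r = 1/3`; H21 half-angle convention
  `criticalWeightI`): `criticalWeightI (α_{x+y}/2)` on the horizontal edge and
  `criticalWeightI ((π - α_{x+y})/2)` on the vertical edge through the track `t_{x+y}`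
  (`trackIndex`, `mixedWeight`), reducing to `isoRectWeight α` for constant angles
  (`mixedWeight_const`); the two weights of a rhombus row are complementary
  (`coe_mixedWeight_horizontal_add_vertical`, GM14 (2.3) `p_θ + p_{π−θ} = 1`);
* `mixedPercolation αs = φ_{𝕃(𝛂)}` at `q = 1`, the product measure (`mixedPercolation_const`:
  `φ_{𝕃(α)} = isoRectPercolation α`);
* `exchangeTracks αs i`, the angle sequence with `α_i` and `α_{i-1}` exchanged (§2.6).

No probabilistic statement about `𝕃(𝛂)` (Theorem 2.2, Proposition 2.11) is made here.

## References

* H. Duminil-Copin, K. K. Kozlowski, D. Krachun, I. Manolescu, M. Oulamara, arXiv:2012.11672v2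
  (2026), §2.1 (isoradial graphs, tracks, `𝕃(𝛂)`), §2.2 (eq. (9)–(10)), §2.6, §3.1.
* G. R. Grimmett, I. Manolescu, PTRF 159 (2014), arXiv:1204.0505, §2.1–2.2 (eq. (2.3)), §4.
-/

noncomputable section

open Complex MeasureTheory
open scoped Real

namespace Literature.Probability.Percolation

open LatticeModels

/-! ### Track heights -/

/-- The height `H(n)` of the row `t⁻_n` of `𝕃(𝛂)`: `H(0) = 0`, `H(n + 1) = H(n) + e^{iα_n}` (the
track `t_n` is a row of rhombi with slanted sides `e^{iα_n}`). [cite: arXiv201211672v2, §2.1] -/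
def trackHeight (αs : ℤ → ℝ) (n : ℤ) : ℂ :=
  (∑ k ∈ Finset.range n.toNat, cexp ((αs k : ℂ) * I)) -
    ∑ k ∈ Finset.range (-n).toNat, cexp ((αs (-((k + 1 : ℕ) : ℤ)) : ℂ) * I)

/-- `H(0) = 0`. [cite: arXiv201211672v2, §2.1] -/
@[simp] theorem trackHeight_zero (αs : ℤ → ℝ) : trackHeight αs 0 = 0 := by
  simp [trackHeight]

/-- `H(m) = Σ_{k<m} e^{iα_k}` for `m ≥ 0`. [cite: arXiv201211672v2, §2.1] -/
theorem trackHeight_natCast (αs : ℤ → ℝ) (m : ℕ) :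
    trackHeight αs m = ∑ k ∈ Finset.range m, cexp ((αs k : ℂ) * I) := by
  simp [trackHeight]

/-- `H(-m) = -Σ_{k<m} e^{iα_{-(k+1)}}` for `m ≥ 0`. [cite: arXiv201211672v2, §2.1] -/
theorem trackHeight_neg_natCast (αs : ℤ → ℝ) (m : ℕ) :
    trackHeight αs (-(m : ℤ)) = -∑ k ∈ Finset.range m, cexp ((αs (-((k + 1 : ℕ) : ℤ)) : ℂ) * I) := by
  simp [trackHeight]

/-- **The recursion of track heights**: `H(n + 1) = H(n) + e^{iα_n}` for every `n ∈ ℤ`. [cite: arXiv201211672v2, §2.1] -/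
theorem trackHeight_add_one (αs : ℤ → ℝ) (n : ℤ) :
    trackHeight αs (n + 1) = trackHeight αs n + cexp ((αs n : ℂ) * I) := by
  rcases le_or_gt 0 n with hn | hn
  · obtain ⟨m, rfl⟩ := Int.eq_ofNat_of_zero_le hn
    have h1 : ((m : ℤ) + 1) = ((m + 1 : ℕ) : ℤ) := by push_cast; ring
    rw [h1, trackHeight_natCast, trackHeight_natCast, Finset.sum_range_succ]
  · obtain ⟨m, hm⟩ := Int.exists_eq_neg_ofNat hn.le
    obtain ⟨m', rfl⟩ : ∃ m', m = m' + 1 := by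
      rcases m with _ | m'
      · simp at hm; omega
      · exact ⟨m', rfl⟩
    subst hm
    have h1 : (-((m' + 1 : ℕ) : ℤ) + 1) = -((m' : ℕ) : ℤ) := by push_cast; ring
    rw [h1, trackHeight_neg_natCast, trackHeight_neg_natCast, Finset.sum_range_succ]
    ring

/-- For constant angles, `H(n) = n e^{iα}`. [cite: arXiv201211672v2, §2.1] -/
theorem trackHeight_const (α : ℝ) (n : ℤ) : trackHeight (fun _ => α) n = n * cexp ((α : ℂ) * I) := by
  induction n using Int.induction_on with
  | zero => simp
  | succ n ih => rw [trackHeight_add_one, ih]; push_cast; ring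
  | pred n ih =>
    have h := trackHeight_add_one (fun _ => α) (-(n : ℤ) - 1)
    rw [sub_add_cancel] at h
    have : trackHeight (fun _ => α) (-(n : ℤ) - 1) = trackHeight (fun _ => α) (-(n : ℤ)) - cexp ((α : ℂ) * I) := by
      rw [h]; ring
    rw [this, ih]; push_cast; ring

/-! ### The embedding of `𝕃(𝛂)` -/

/-- **The vertex of `δ𝕃(𝛂)` at the site `(x, y)` of `ℤ²`**: horizontal position `x - y` in the
row `t⁻_{x+y}`, height `H(x + y)`: `δ ((x - y) + H(x + y))`. (DKKMO, arXiv:2012.11672v2, §2.1: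
"`t⁺_{i-1} = t⁻_i` for the set of vertices between `t_{i-1}` and `t_i`"; Figure 2.) [cite: arXiv201211672v2, §2.1] -/
def mixedPoint (δ : ℝ) (αs : ℤ → ℝ) (x : Site 2) : ℂ :=
  (δ : ℂ) * ((((x 0 - x 1 : ℤ)) : ℂ) + trackHeight αs (x 0 + x 1))

/-- **The "horizontal" edge through the track `t_{x+y}` is the long diagonal of its rhombus**:
`mixedPoint (x + e₀) - mixedPoint x = δ (1 + e^{iα_{x+y}})`. [cite: arXiv201211672v2, §2.1] -/
theorem mixedPoint_add_single_zero (δ : ℝ) (αs : ℤ → ℝ) (x : Site 2) :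
    mixedPoint δ αs (x + Pi.single 0 1) - mixedPoint δ αs x = δ * (1 + cexp ((αs (x 0 + x 1) : ℂ) * I)) := by
  simp only [mixedPoint, Pi.add_apply, Pi.single_eq_same, Pi.single_eq_of_ne (one_ne_zero : (1 : Fin 2) ≠ 0)]
  rw [show x 0 + 1 + (x 1 + 0) = (x 0 + x 1) + 1 by ring, trackHeight_add_one]
  push_cast
  ring

/-- **The "vertical" edge through the track `t_{x+y}` is the short diagonal of its rhombus**:
`mixedPoint (x + e₁) - mixedPoint x = δ (e^{iα_{x+y}} - 1)`. [cite: arXiv201211672v2, §2.1] -/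
theorem mixedPoint_add_single_one (δ : ℝ) (αs : ℤ → ℝ) (x : Site 2) :
    mixedPoint δ αs (x + Pi.single 1 1) - mixedPoint δ αs x = δ * (cexp ((αs (x 0 + x 1) : ℂ) * I) - 1) := by
  simp only [mixedPoint, Pi.add_apply, Pi.single_eq_same, Pi.single_eq_of_ne (zero_ne_one : (0 : Fin 2) ≠ 1)]
  rw [show x 0 + 0 + (x 1 + 1) = (x 0 + x 1) + 1 by ring, trackHeight_add_one]
  push_cast
  ring

/-- `1 + e^{iα} = 2 cos(α/2) e^{iα/2}`. [folklore] -/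
theorem one_add_exp_mul_I (α : ℝ) :
    1 + cexp ((α : ℂ) * I) = 2 * Complex.cos ((α / 2 : ℝ) : ℂ) * cexp (((α / 2 : ℝ) : ℂ) * I) := by
  rw [Complex.two_cos]
  have h : cexp (((α / 2 : ℝ) : ℂ) * I) * cexp (((α / 2 : ℝ) : ℂ) * I) = cexp ((α : ℂ) * I) := by
    rw [← Complex.exp_add]; congr 1; push_cast; ring
  have h' : cexp (-(((α / 2 : ℝ) : ℂ)) * I) * cexp (((α / 2 : ℝ) : ℂ) * I) = 1 := by
    rw [← Complex.exp_add, neg_mul, neg_add_cancel, Complex.exp_zero]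
  linear_combination (-1 : ℂ) * h - h'

/-- `e^{iα} - 1 = 2 sin(α/2) · i e^{iα/2}`. [folklore] -/
theorem exp_mul_I_sub_one (α : ℝ) :
    cexp ((α : ℂ) * I) - 1 = 2 * Complex.sin ((α / 2 : ℝ) : ℂ) * I * cexp (((α / 2 : ℝ) : ℂ) * I) := by
  rw [Complex.two_sin]
  have h : cexp (((α / 2 : ℝ) : ℂ) * I) * cexp (((α / 2 : ℝ) : ℂ) * I) = cexp ((α : ℂ) * I) := by
    rw [← Complex.exp_add]; congr 1; push_cast; ring
  have h' : cexp (-(((α / 2 : ℝ) : ℂ)) * I) * cexp (((α / 2 : ℝ) : ℂ) * I) = 1 := by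
    rw [← Complex.exp_add, neg_mul, neg_add_cancel, Complex.exp_zero]
  linear_combination (-1 : ℂ) * h + (-(I ^ 2)) * h' +
    (cexp (((α / 2 : ℝ) : ℂ) * I) ^ 2 - 1) * Complex.I_sq

/-- **Edge lengths** (§1.4/§2.1: "horizontal edges have length `2 cos(α/2)`"): `‖1 + e^{iα}‖ =
2 cos(α/2)` for `α ∈ (0, π)`. [cite: arXiv201211672v2, §1.4] -/
theorem norm_one_add_exp_mul_I {α : ℝ} (hα : α ∈ Set.Ioo 0 π) :
    ‖1 + cexp ((α : ℂ) * I)‖ = 2 * Real.cos (α / 2) := by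
  have hc : 0 < Real.cos (α / 2) :=
    Real.cos_pos_of_mem_Ioo ⟨by linarith [hα.1, Real.pi_pos], by linarith [hα.2, Real.pi_pos]⟩
  rw [one_add_exp_mul_I, ← Complex.ofReal_cos, norm_mul, norm_mul, Complex.norm_exp_ofReal_mul_I,
    Complex.norm_real, Real.norm_eq_abs, abs_of_pos hc]
  simp

/-- **Edge lengths**: `‖e^{iα} - 1‖ = 2 sin(α/2)` for `α ∈ (0, π)` ("vertical edges have length
`2 sin(α/2)`"). [cite: arXiv201211672v2, §1.4] -/
theorem norm_exp_mul_I_sub_one {α : ℝ} (hα : α ∈ Set.Ioo 0 π) :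
    ‖cexp ((α : ℂ) * I) - 1‖ = 2 * Real.sin (α / 2) := by
  have hs : 0 < Real.sin (α / 2) :=
    Real.sin_pos_of_pos_of_lt_pi (by linarith [hα.1]) (by linarith [hα.2, Real.pi_pos])
  rw [exp_mul_I_sub_one, ← Complex.ofReal_sin, norm_mul, norm_mul, norm_mul, Complex.norm_exp_ofReal_mul_I,
    Complex.norm_real, Real.norm_eq_abs, abs_of_pos hs, Complex.norm_I]
  simp

/-- **For constant angles `𝕃(𝛂) = 𝕃(α)`**: `mixedPoint δ (fun _ ↦ α) = isoRectPoint δ α`, the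
embedding `(x, y) ↦ e^{iα/2}(2 cos(α/2) x + 2 sin(α/2) y i)` of `IsoradialRectangularLoops`
(DKKMO §2.1: "When `α_i = α` for every `i`, simply write `𝕃(α) = 𝕃(𝛂)`. [...] These are indeed the
isoradial rectangular lattices described in Section 1.4"). [cite: arXiv201211672v2, §2.1] -/
theorem mixedPoint_const (δ α : ℝ) (x : Site 2) : mixedPoint δ (fun _ => α) x = isoRectPoint δ α x := by
  rw [isoRectPoint, isoRectLinear_apply, meshPoint_re, meshPoint_im, mixedPoint, trackHeight_const]
  have hc := one_add_exp_mul_I α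
  have hs := exp_mul_I_sub_one α
  push_cast at hc hs ⊢
  linear_combination ((δ : ℂ) * (x 0 : ℂ)) * hc + ((δ : ℂ) * (x 1 : ℂ)) * hs

/-! ### Critical weights and the percolation measure `φ_{𝕃(𝛂)}` at `q = 1` -/

/-- The index of the horizontal track crossed by the edge `{a, b}` of `ℤ²`: the edge joins the
rows `t⁻_i` and `t⁻_{i+1}` with `i = min(a₀ + a₁, b₀ + b₁)`, and crosses `t_i`. [cite: arXiv201211672v2, §2.1] -/
def trackIndex : Sym2 (Site 2) → ℤ :=
  Sym2.lift ⟨fun a b => min (a 0 + a 1) (b 0 + b 1), fun _ _ => min_comm _ _⟩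

/-- `trackIndex` on an explicit pair. [folklore] -/
@[simp] theorem trackIndex_mk (a b : Site 2) : trackIndex s(a, b) = min (a 0 + a 1) (b 0 + b 1) := rfl

open scoped Classical in
/-- **The critical weights of `φ_{𝕃(𝛂)}` at `q = 1`** (DKKMO §2.2, eq. (9) with `r = 1/3`, in the
H21 half-angle convention of `criticalWeightI`): the horizontal edge through the track `t_i`
is the long diagonal of a rhombus of half-angle `α_i/2` and gets `criticalWeightI (α_i/2)`, the
vertical edge through `t_i` is the short diagonal (half-angle `(π - α_i)/2`) and gets
`criticalWeightI ((π - α_i)/2)`; non-edges get `0`. For constant angles these are the weights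
`isoRectWeight α` of §1.4 eq. (5) (`mixedWeight_const`). [cite: arXiv201211672v2, §2.2] -/
def mixedWeight (αs : ℤ → ℝ) (e : Sym2 (Site 2)) : unitInterval :=
  if e ∈ (zdGraph 2).edgeSet then
    (if IsHorizontal e then criticalWeightI (αs (trackIndex e) / 2)
      else criticalWeightI ((π - αs (trackIndex e)) / 2))
  else 0

/-- For constant angles the weights are those of `𝕃(α)`. [cite: arXiv201211672v2, §2.1] -/
theorem mixedWeight_const (α : ℝ) : mixedWeight (fun _ => α) = isoRectWeight α := by
  funext e
  unfold mixedWeight isoRectWeight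
  rfl

/-- **The percolation measure `φ_{𝕃(𝛂)}` at `q = 1`**: independent edges of `ℤ²` with the
critical isoradial weights `mixedWeight αs` (at `q = 1` the infinite-volume random-cluster
measure of DKKMO §2.2 is this product measure). [cite: arXiv201211672v2, §2.2] -/
def mixedPercolation (αs : ℤ → ℝ) : Measure (BondConfig (Site 2)) := prodBernoulli (mixedWeight αs)

/-- `φ_{𝕃(𝛂)}` is a probability measure. [cite: arXiv201211672v2, §2.2] -/
instance instIsProbabilityMeasureMixedPercolation (αs : ℤ → ℝ) : IsProbabilityMeasure (mixedPercolation αs) := by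
  unfold mixedPercolation; infer_instance

/-- For constant angles, `φ_{𝕃(𝛂)} = φ_{𝕃(α)} = isoRectPercolation α`. [cite: arXiv201211672v2, §2.1] -/
theorem mixedPercolation_const (α : ℝ) : mixedPercolation (fun _ => α) = isoRectPercolation α := by
  rw [mixedPercolation, mixedWeight_const, isoRectPercolation]

/-- The horizontal edge `(x, y) → (x+1, y)` crosses the track `t_{x+y}`. [cite: arXiv201211672v2, §2.1] -/
theorem trackIndex_horizontal (x : Site 2) : trackIndex s(x, x + Pi.single 0 1) = x 0 + x 1 := by
  rw [trackIndex_mk]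
  simp only [Pi.add_apply, Pi.single_eq_same, Pi.single_eq_of_ne (one_ne_zero : (1 : Fin 2) ≠ 0)]
  exact min_eq_left (by omega)

/-- The vertical edge `(x, y) → (x, y+1)` crosses the track `t_{x+y}`. [cite: arXiv201211672v2, §2.1] -/
theorem trackIndex_vertical (x : Site 2) : trackIndex s(x, x + Pi.single 1 1) = x 0 + x 1 := by
  rw [trackIndex_mk]
  simp only [Pi.add_apply, Pi.single_eq_same, Pi.single_eq_of_ne (zero_ne_one : (0 : Fin 2) ≠ 1)]
  exact min_eq_left (by omega)

/-- The weight of the horizontal edge `(x, y) → (x+1, y)` is `criticalWeightI (α_{x+y}/2)`. [cite: arXiv201211672v2, §2.2] -/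
theorem mixedWeight_horizontal (αs : ℤ → ℝ) (x : Site 2) :
    mixedWeight αs s(x, x + Pi.single 0 1) = criticalWeightI (αs (x 0 + x 1) / 2) := by
  classical
  have he : s(x, x + Pi.single 0 1) ∈ (zdGraph 2).edgeSet :=
    (SimpleGraph.mem_edgeSet _).2 ((zdGraph_adj_iff _ _).2 ⟨0, Or.inl rfl⟩)
  have hh : IsHorizontal s(x, x + Pi.single 0 1) := by
    rw [isHorizontal_mk]; simp
  unfold mixedWeight
  rw [if_pos he, if_pos hh, trackIndex_horizontal]

/-- The weight of the vertical edge `(x, y) → (x, y+1)` is `criticalWeightI ((π - α_{x+y})/2)`. [cite: arXiv201211672v2, §2.2] -/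
theorem mixedWeight_vertical (αs : ℤ → ℝ) (x : Site 2) :
    mixedWeight αs s(x, x + Pi.single 1 1) = criticalWeightI ((π - αs (x 0 + x 1)) / 2) := by
  classical
  have he : s(x, x + Pi.single 1 1) ∈ (zdGraph 2).edgeSet :=
    (SimpleGraph.mem_edgeSet _).2 ((zdGraph_adj_iff _ _).2 ⟨1, Or.inl rfl⟩)
  have hh : ¬ IsHorizontal s(x, x + Pi.single 1 1) := by
    rw [isHorizontal_mk]; simp
  unfold mixedWeight
  rw [if_pos he, if_neg hh, trackIndex_vertical]

/-- **The two edges of `ℤ²` at `(x, y)` through the track `t_{x+y}` carry complementary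
weights**, `p_hor + p_vert = 1` (the short diagonal is the dual direction of the long one;
GM14 (2.3): "`p_θ + p_{π−θ} = 1`"; DKKMO eq. (5) at `q = 1`: `p_hor/(1 - p_hor) = (1 - p_vert)/p_vert`). [cite: GrimmettManolescuPTRF2014, (2.3)] -/
theorem coe_mixedWeight_horizontal_add_vertical (αs : ℤ → ℝ) (x : Site 2)
    (hα : αs (x 0 + x 1) ∈ Set.Ioo 0 π) :
    (mixedWeight αs s(x, x + Pi.single 0 1) : ℝ) + mixedWeight αs s(x, x + Pi.single 1 1) = 1 := by
  rw [mixedWeight_horizontal, mixedWeight_vertical]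
  set α := αs (x 0 + x 1) with hαdef
  have h1 : α / 2 ∈ Set.Icc 0 (π / 2) := ⟨by linarith [hα.1], by linarith [hα.2]⟩
  have h2 : (π - α) / 2 ∈ Set.Icc 0 (π / 2) := ⟨by linarith [hα.2], by linarith [hα.1]⟩
  rw [coe_criticalWeightI_holds h1, coe_criticalWeightI_holds h2,
    show (π - α) / 2 = π / 2 - α / 2 by ring,
    StarTriangle.criticalWeight_pi_div_two_sub ⟨by linarith [hα.1], by linarith [hα.2]⟩]
  ring

/-! ### Exchanging two tracks -/

/-- **The angle sequence with the tracks `t_i` and `t_{i-1}` exchanged** (DKKMO §2.6: "let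
`𝕃' = 𝕃(𝛂')` be the lattice obtained by exchanging the tracks `t_i` and `t_{i-1}` (i.e. by
exchanging `α_i` and `α_{i-1}` in the sequence `𝛂`)"). [cite: arXiv201211672v2, §2.6] -/
def exchangeTracks (αs : ℤ → ℝ) (i : ℤ) : ℤ → ℝ := αs ∘ Equiv.swap i (i - 1)

/-- Exchanging twice gives back the sequence. [folklore] -/
theorem exchangeTracks_exchangeTracks (αs : ℤ → ℝ) (i : ℤ) :
    exchangeTracks (exchangeTracks αs i) i = αs := by
  funext n
  simp [exchangeTracks, Equiv.swap_apply_self]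

/-- The exchanged sequence at `i` is `α_{i-1}`. [folklore] -/
@[simp] theorem exchangeTracks_apply_self (αs : ℤ → ℝ) (i : ℤ) : exchangeTracks αs i i = αs (i - 1) := by
  simp [exchangeTracks, Equiv.swap_apply_left]

/-- The exchanged sequence at `i - 1` is `α_i`. [folklore] -/
@[simp] theorem exchangeTracks_apply_pred (αs : ℤ → ℝ) (i : ℤ) : exchangeTracks αs i (i - 1) = αs i := by
  simp [exchangeTracks, Equiv.swap_apply_right]

/-- The exchanged sequence agrees with `αs` off `{i - 1, i}`. [folklore] -/
theorem exchangeTracks_apply_of_ne (αs : ℤ → ℝ) {i n : ℤ} (h1 : n ≠ i) (h2 : n ≠ i - 1) :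
    exchangeTracks αs i n = αs n := by
  simp [exchangeTracks, Equiv.swap_apply_of_ne_of_ne h1 h2]

/-- For a constant sequence the exchange is trivial (`𝐓_i = id` when `α_i = α_{i-1}`). [cite: arXiv201211672v2, §2.6] -/
theorem exchangeTracks_const (α : ℝ) (i : ℤ) : exchangeTracks (fun _ => α) i = fun _ => α := rfl

end Literature.Probability.Percolation

end
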